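import Literature.AlgebraicGeometry.Frobenioids.RlfPerfFactorialWeak
import Literature.AnabelianGeometry.EtaleTheta.RealificationUniversalWeak
import Literature.AnabelianGeometry.EtaleTheta.RealificationFunctor
import Literature.AnabelianGeometry.EtaleTheta.FrdIVocabularyWeak

/-!
# The realification `Φ ↦ Φ^rlf` as a functor — for WEAKLY perf-factorial values with cofinal perfection
# ([FrdI] Prop. 5.3; [EtTh] Def. 3.6 (i) `Φ₀^ℝ := Φ₀^rlf` at coverings with infinitely many components)

Sources: S. Mochizuki, *The geometry of Frobenioids I* [MochizukiFrdI2008], Def. 2.4 (i) p. 48 (the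
realification `M^rlf`) and Prop. 5.3 p. 103 ("the divisor monoid `Φ^rlf`"); S. Mochizuki, *The étale
theta function …* [MochizukiEtTh2009], Def. 3.6 (i), PDF p. 76 (printed 302): "`Φ₀^ℝ := Φ₀^rlf` … where
`Φ₀^rlf` is as in [FrdI], Definition 2.4, (i) [cf. Proposition 3.4, (i)]".

WEAK-HYPOTHESIS TWIN of `RealificationFunctor.lean` (seat abc-iut-L2-d2): print applies `M ↦ M^rlf` to the
monoid-valued functor `Φ₀` without comment, and Prop. 3.4 (i) asserts "`Φ₀(Y^log)` is perf-factorial";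
cell finding F-L2d2-1 (kernel witness `PerfFactorialProductCounterexample.not_isPerfFactorial_multiplicative_pi_nat`):
at tempered coverings with infinitely many special-fibre components (`Ÿ`, `Z_∞`) condition (d) of [FrdI]
Def. 2.4 (i) FAILS for `Φ₀(Y^log) ⊇ ∏_j ℤ_{≥0}`, so the printed hypothesis of the strong functor
`rlfFunctor Φ hΦ` is unsatisfiable there.  The cell's repaired reading (abc-iut-L2-t3's
`treeMonoidVocabWeak`, F-L2d2-2): "perf-factorial" := `IsPerfFactorialCof` = weakly perf-factorial
((a)(b)(c)+(d_ord)+(d_res)) with COFINAL perfection ((d_cof), Mochizuki's sentence "for every `a ∈ P^rlf`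
there exists `a' ∈ P^pf` such that `a' ≥ a`", Lemma 3.5 p. 75) — satisfied by `∏_J ℤ_{≥0}`.  THIS FILE
constructs the realification functor under that hypothesis, from abc-iut-L2-d2's weak universal property
(`RealificationUniversalWeak.lean`: `RlfUniversalWeak.existsUnique_map`, `map_id`, `map_comp`) and
"`ℝ` supports `M^rlf`" for weak `M` (`IsPerfFactorialWeak.supports_rlf_R`, `RlfPerfFactorialWeak.lean`):

* `IsPerfFactorialCof.weak / .rlfCofinal`: the two components of the hypothesis;
* `rlfMapWeak Φ hΦ f : Φ(j)^rlf → Φ(j')^rlf`, the unique homomorphism over `Φ(f)^pf`; `rlfMapWeak_id`,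
  `rlfMapWeak_comp`; `rlfFunctorWeak Φ hΦ : J ⥤ CommMonCat` and `toRlfNatTransWeak : Φ ⟶ Φ^rlf`;
* `isRealificationViaWeak_toRealification`: each component is a realification in the sense of
  `IsRealificationViaWeak` (`FrdIVocabularyWeak.lean`) — the fields `ΦR`, `toR`, `toR_natural`,
  `isRealification` of [EtTh] Def. 3.6 (i) data over `treeMonoidVocabWeak` are CONSTRUCTIBLE;
* `RealifiedDivisorMonoids.nonempty_iso_rlfFunctorWeak`: rigidity — for ANY Def. 3.6 (i) data `T` over
  `treeMonoidVocabWeak` whose `Φ₀(Y)` have cofinal perfections, `T.ΦR ≅ rlfFunctorWeak T.Φ₀` compatibly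
  with `toR`.

For perf-factorial values the weak objects are the printed ones (`h.weak.realification = h.realification`
by `rfl`), so this subsumes the strong functor.  Seat abc-iut-L6-t12 (cell abc-iut; F-L2d2-1 / F-L2d2-2
repair chain, split with abc-iut-L2-d2 2026-08-26T03:42Z, piece (B)).  HONEST FRAMING: a construction
inside [FrdI] Def. 2.4 / Prop. 5.3; nothing of [EtTh] is asserted; nothing here bears on [IUTchIII] Cor. 3.12.
-/

noncomputable section

namespace Literature.AnabelianGeometry.EtaleTheta

open CategoryTheory Literature.AlgebraicGeometry.Frobenioids

universe w v u

/-! ### The two components of `IsPerfFactorialCof` -/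

/-- The weakly-perf-factorial structure underlying `IsPerfFactorialCof M` (a `Prop`; any two proofs are
equal, so `h.Rlf` does not depend on the choice). [cite: MochizukiFrdI2008, Def. 2.4(i) p.47] -/
theorem IsPerfFactorialCof.weak {M : Type w} [CommMonoid M] (hc : IsPerfFactorialCof M) :
    IsPerfFactorialWeak M :=
  hc.elim fun h _ => h

/-- The cofinality clause (d_cof) of `IsPerfFactorialCof M`: "for every `a ∈ M^rlf` there exists
`a' ∈ M^pf` such that `a' ≥ a`". [cite: MochizukiEtTh2009, Lem 3.5 p.75] -/
theorem IsPerfFactorialCof.rlfCofinal {M : Type w} [CommMonoid M] (hc : IsPerfFactorialCof M) :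
    RlfCofinal hc.weak :=
  hc.elim fun _ hh => hh

section RlfFunctorWeak

variable {J : Type u} [Category.{v} J] (Φ : J ⥤ CommMonCat.{w})
  (hΦ : ∀ j : J, IsPerfFactorialCof (Φ.obj j))

/-- **`Φ(f)^rlf`** (weak values): for `f : j → j'`, the unique homomorphism `Φ(j)^rlf → Φ(j')^rlf` over
`Φ(f)^pf : Φ(j)^pf → Φ(j')^pf` (weak universal property of the realification: source with cofinal
perfection, `ℝ` supports `Φ(j')^rlf`). [cite: MochizukiFrdI2008, Prop. 5.3 p.103] -/
def rlfMapWeak {j j' : J} (f : j ⟶ j') : (hΦ j).weak.Rlf →* (hΦ j').weak.Rlf :=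
  Classical.choose (RlfUniversalWeak.existsUnique_map (hΦ j).weak (hΦ j).rlfCofinal (hΦ j').weak
    (hΦ j').weak.supports_rlf_R (Φ.map f).hom).exists

/-- The defining property of `rlfMapWeak`: it lies over `Φ(f)^pf`. [cite: MochizukiFrdI2008, Prop. 5.3 p.103] -/
theorem rlfMapWeak_comp_toRealification {j j' : J} (f : j ⟶ j') :
    (rlfMapWeak Φ hΦ f).comp (hΦ j).weak.toRealification =
      (hΦ j').weak.toRealification.comp (Perfection.map (Φ.map f).hom) :=
  Classical.choose_spec (RlfUniversalWeak.existsUnique_map (hΦ j).weak (hΦ j).rlfCofinal (hΦ j').weak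
    (hΦ j').weak.supports_rlf_R (Φ.map f).hom).exists

/-- `rlfMapWeak` on the image of `Φ(j)`: `Φ(f)^rlf (a) = Φ(f)(a)` for `a ∈ Φ(j)` (through `Φ → Φ^pf → Φ^rlf`).
[cite: MochizukiFrdI2008, Prop. 5.3 p.103] -/
theorem rlfMapWeak_toRealification_of {j j' : J} (f : j ⟶ j') (a : Φ.obj j) :
    rlfMapWeak Φ hΦ f ((hΦ j).weak.toRealification (Perfection.of _ a)) =
      (hΦ j').weak.toRealification (Perfection.of _ ((Φ.map f).hom a)) := by
  have h := DFunLike.congr_fun (rlfMapWeak_comp_toRealification Φ hΦ f) (Perfection.of _ a)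
  rw [MonoidHom.comp_apply, MonoidHom.comp_apply] at h
  rw [h]
  rfl

/-- `Φ(𝟙)^rlf = 𝟙`. [cite: MochizukiFrdI2008, Prop. 5.3 p.103] -/
theorem rlfMapWeak_id (j : J) : rlfMapWeak Φ hΦ (𝟙 j) = MonoidHom.id _ := by
  apply RlfUniversalWeak.map_id (hΦ j).weak (hΦ j).rlfCofinal (hΦ j).weak.supports_rlf_R
  rw [rlfMapWeak_comp_toRealification, CategoryTheory.Functor.map_id]
  rfl

/-- `Φ(f ≫ g)^rlf = Φ(g)^rlf ∘ Φ(f)^rlf`. [cite: MochizukiFrdI2008, Prop. 5.3 p.103] -/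
theorem rlfMapWeak_comp {j j' j'' : J} (f : j ⟶ j') (g : j' ⟶ j'') :
    rlfMapWeak Φ hΦ (f ≫ g) = (rlfMapWeak Φ hΦ g).comp (rlfMapWeak Φ hΦ f) := by
  apply RlfUniversalWeak.map_comp (hΦ j).weak (hΦ j).rlfCofinal (hΦ j').weak (hΦ j'').weak
    (hΦ j'').weak.supports_rlf_R (Φ.map f).hom (Φ.map g).hom
    (rlfMapWeak Φ hΦ f) (rlfMapWeak_comp_toRealification Φ hΦ f) (rlfMapWeak Φ hΦ g)
    (rlfMapWeak_comp_toRealification Φ hΦ g)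
  rw [rlfMapWeak_comp_toRealification, Functor.map_comp]
  rfl

/-- **The realification functor `Φ^rlf : J ⥤ CommMonCat`** for weakly perf-factorial values with cofinal
perfection, `j ↦ Φ(j)^rlf` ("the divisor monoid `Φ^rlf`", [FrdI] Prop. 5.3; "`Φ₀^ℝ := Φ₀^rlf`", [EtTh]
Def. 3.6 (i) — now available at `Ÿ`, `Z_∞`). [cite: MochizukiFrdI2008, Prop. 5.3 p.103] -/
def rlfFunctorWeak : J ⥤ CommMonCat.{w} where
  obj j := CommMonCat.of (hΦ j).weak.Rlf
  map f := CommMonCat.ofHom (rlfMapWeak Φ hΦ f)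
  map_id j := by
    rw [rlfMapWeak_id]
    rfl
  map_comp f g := by
    rw [rlfMapWeak_comp]
    rfl

/-- `(Φ^rlf).map f` is `rlfMapWeak`. [cite: MochizukiFrdI2008, Prop. 5.3 p.103] -/
@[simp] theorem rlfFunctorWeak_map_hom {j j' : J} (f : j ⟶ j') :
    ((rlfFunctorWeak Φ hΦ).map f).hom = rlfMapWeak Φ hΦ f := rfl

/-- **The natural transformation `Φ ⟶ Φ^rlf`** (weak values), `Φ(j) → Φ(j)^pf → Φ(j)^rlf` ([EtTh]
Def. 3.6 (i): "the natural map `Φ₀ → Φ₀^pf → Φ₀^rlf = Φ₀^ℝ`"). [cite: MochizukiEtTh2009, Def 3.6 p.76] -/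
def toRlfNatTransWeak : Φ ⟶ rlfFunctorWeak Φ hΦ where
  app j := CommMonCat.ofHom ((hΦ j).weak.toRealification.comp (Perfection.of _))
  naturality := by
    intro j j' f
    ext a
    exact (rlfMapWeak_toRealification_of Φ hΦ f a).symm

/-- Components of `Φ ⟶ Φ^rlf` (weak values). [cite: MochizukiEtTh2009, Def 3.6 p.76] -/
@[simp] theorem toRlfNatTransWeak_app_hom (j : J) :
    ((toRlfNatTransWeak Φ hΦ).app j).hom = (hΦ j).weak.toRealification.comp (Perfection.of _) := rfl

/-- Each `Φ(j) → Φ(j)^rlf` exhibits `Φ(j)^rlf` as the realification of `Φ(j)` in the sense of the WEAK §3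
vocabulary (`IsRealificationViaWeak`, `FrdIVocabularyWeak.lean`). [cite: MochizukiEtTh2009, Def 3.6 p.76] -/
theorem isRealificationViaWeak_toRealification {M : Type w} [CommMonoid M] (hM : IsPerfFactorialWeak M) :
    IsRealificationViaWeak M hM.Rlf (hM.toRealification.comp (Perfection.of M)) :=
  ⟨hM, MulEquiv.refl _, fun _ => rfl⟩

end RlfFunctorWeak

/-! ### Rigidity of the Def. 3.6 (i) realification data over the weak vocabulary -/

namespace RealifiedDivisorMonoids

variable {D₀ : Type u} [Category.{v} D₀]
  (T : RealifiedDivisorMonoids (D₀ := D₀) treeMonoidVocabWeak.{w})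

/-- For Def. 3.6 (i) data over the WEAK vocabulary, every `Φ₀(Y)` is weakly perf-factorial (part of the
field `isRealification : IsRealificationViaWeak …`). [cite: MochizukiEtTh2009, Def 3.6 p.76] -/
theorem isPerfFactorialWeak_Φ₀ (Y : D₀ᵒᵖ) : IsPerfFactorialWeak (T.Φ₀.obj Y) :=
  (T.isRealification Y).elim fun h _ => h

/-- **Rigidity of `Φ₀^ℝ` (weak vocabulary).** For any Def. 3.6 (i) data `T` over `treeMonoidVocabWeak`
whose divisor monoids `Φ₀(Y)` have cofinal perfections (`hΦ`; e.g. the repaired Prop. 3.4 (i)), there is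
an isomorphism of functors `T.ΦR ≅ (T.Φ₀)^rlf` (the weak realification functor) carrying `T.toR` to the
natural maps `Φ₀ → Φ₀^pf → Φ₀^rlf`: the data `ΦR, toR, toR_natural, isRealification` are determined up to
unique isomorphism (weak universal property). [cite: MochizukiEtTh2009, Def 3.6 p.76] -/
theorem nonempty_iso_rlfFunctorWeak (hΦ : ∀ Y : D₀ᵒᵖ, IsPerfFactorialCof (T.Φ₀.obj Y)) :
    ∃ e : T.ΦR ≅ rlfFunctorWeak T.Φ₀ hΦ,
      ∀ (Y : D₀ᵒᵖ) (m : T.Φ₀.obj Y),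
        (e.hom.app Y).hom (T.toR Y m) =
          (hΦ Y).weak.toRealification (Perfection.of _ m) := by
  -- the isomorphisms `e_Y : Φ₀^ℝ(Y) ≅ Φ₀(Y)^rlf` of `IsRealificationViaWeak`
  have hE : ∀ Y : D₀ᵒᵖ, ∃ eY : T.ΦR.obj Y ≃* (hΦ Y).weak.Rlf,
      ∀ m, eY (T.toR Y m) = (hΦ Y).weak.toRealification (Perfection.of _ m) := by
    intro Y
    obtain ⟨h, eY, heY⟩ := T.isRealification Y
    exact ⟨eY, heY⟩
  choose eY heY using hE
  -- naturality: `e_{Y'} ∘ Φ₀^ℝ(f) ∘ e_Y⁻¹` is a map of realifications over `Φ₀(f)^pf`, hence `= rlfMapWeak f`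
  have hnat : ∀ {Y Y' : D₀ᵒᵖ} (f : Y ⟶ Y'),
      ((eY Y').toMonoidHom.comp (T.ΦR.map f).hom).comp (eY Y).symm.toMonoidHom =
        rlfMapWeak T.Φ₀ hΦ f := by
    intro Y Y' f
    apply (RlfUniversalWeak.existsUnique_map (hΦ Y).weak (hΦ Y).rlfCofinal (hΦ Y').weak
      (hΦ Y').weak.supports_rlf_R (T.Φ₀.map f).hom).unique _
      (rlfMapWeak_comp_toRealification T.Φ₀ hΦ f)
    -- both sides agree on `Φ₀(Y)`, hence on `Φ₀(Y)^pf` (the target `Φ₀(Y')^rlf` is perfect)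
    apply Perfection.hom_ext_of_isPerfect (hΦ Y').weak.supports_rlf_R.1
    refine MonoidHom.ext fun m => ?_
    have h1 : (eY Y).symm ((hΦ Y).weak.toRealification (Perfection.of _ m)) = T.toR Y m := by
      rw [MulEquiv.symm_apply_eq, heY]
    show eY Y' ((T.ΦR.map f).hom ((eY Y).symm ((hΦ Y).weak.toRealification
        (Perfection.of _ m)))) =
      (hΦ Y').weak.toRealification (Perfection.map (T.Φ₀.map f).hom (Perfection.of _ m))
    rw [h1, ← T.toR_natural, heY]
    rfl
  refine ⟨NatIso.ofComponents (fun Y => (eY Y).toCommMonCatIso) (fun {Y Y'} f => ?_), fun Y m => heY Y m⟩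
  ext x
  have h := DFunLike.congr_fun (hnat f) (eY Y x)
  simp only [MonoidHom.comp_apply, MulEquiv.coe_toMonoidHom, MulEquiv.symm_apply_apply] at h
  exact h

end RealifiedDivisorMonoids

end Literature.AnabelianGeometry.EtaleTheta

end
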